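import Mathlib
import Summits.BirchSwinnertonDyer.BirchSwinnertonDyer.Theorems.ResidualThetaTransportAtTwoSignedMuSeedAtTwoPlusNonsquareDescentHilbertNinety
import HarnessLib

/-!
# Non-square descent — HILBERT 90 SURVIVES FLAT BASE CHANGE AND IDEMPOTENT CUTS (`χ`-parts), and a kernel-transport glue: the bookkeeping that feeds
# `…HilbertNinety` / `…CapitulationSplit` / `…CapitulationKernel` from the tree's Hilbert 90 (line `nonsquare-descent`, stub S2 residue) —
# seed crux `SignedMuSeedAtTwoPlus` stmt-BirchSwinnertonDyer-21438 (parent Kμ⁺ `SignedMuVanishingAtTwoPlus` stmt-BirchSwinnertonDyer-20689,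
# route ResidualThetaTransportAtTwo), line card `Cruxes/SignedMuSeedAtTwoPlus/Lines/nonsquare-descent.md`

Cell `bsd-wall`, width seat `bsd-wall-rtt-p4-w2` g19 (`--supports`, closes nothing).  THEOREMS ONLY; BSD is not proved by this and nothing
arithmetic is asserted: module algebra over a commutative ring.

`…HilbertNinety` takes Hilbert 90 in Tate form on the module it is applied to: `B[ν] ≤ ωB` for `B` killed by `ν ω`.  The tree HAS Hilbert 90 for a
cyclic extension `M_m/M_n` on `B₀ = M_m^×` (`Literature.Algebra.Homology.CyclicExtension.isZero_tateCohomology_units_negOne`, `Rep` currency), while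
the line works with `B = (M_m^× ⊗_ℤ 𝒪)^χ` (`𝒪 = ℤ₂[ζ₃]` free over `ℤ`, `e_χ ∈ 𝒪[Δ]` an idempotent since `3 ∈ 𝒪ˣ`).  This file is the transfer:

* §1 exactness form: `exact_lsmul_iff` (`B[ν] ≤ ωB ∧ νωB = 0 ⟺ B →ω B →ν B exact`).
* §2 FLAT BASE CHANGE: `lTensor_lsmul` (`(ω•) ⊗ S = ω•` on `S ⊗ B`), **`torsionBy_tensor_le_smul_top`** (`S` flat over `R`:
  `(S ⊗ B)[ν] ≤ ω(S ⊗ B)`, Mathlib `Module.Flat.lTensor_exact`), `smul_tensor_eq_zero` (`νω` still kills).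
* §3 IDEMPOTENT CUTS: `mem_smul_top_iff_of_idempotent` (`x ∈ eB ↔ ex = x`), **`inf_torsionBy_le_smul_of_idempotent`** (`eB ∩ B[ν] ≤ ω(eB)`),
  **`torsionBy_submodule_le_smul_top_of_idempotent`** (the same in `↥(eB)`-currency: `(eB)[ν] ≤ ω • ⊤`, ready for `…HilbertNinety`).
* §4 KERNEL TRANSPORT GLUE: **`natCard_ker_eq_of_square`** — for a commuting square `eB ∘ f = g ∘ eA` with `eA` a linear equivalence and `eB` injective,
  `#ker f = #ker g` (how `#ker(I_n/P_n → I/P)` of `…CapitulationSplit` becomes `#ker(X/ω_nX → X/ω_mX)` of `…CapitulationKernel` under the ARITHMETIC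
  identification `A_k^χ ≅ X^χ/ω_kX^χ`).

[folklore]
-/

set_option autoImplicit false
-- the Theorems namespace of this sub repeats the summit name by design (D-0017 nested layout)
set_option linter.dupNamespace false

open scoped Pointwise TensorProduct

namespace Summit.BirchSwinnertonDyer.BirchSwinnertonDyer.Theorems.SignedMuAtTwo.NonsquareDescent

universe u v w

variable {R : Type u} [CommRing R] {B : Type v} [AddCommGroup B] [Module R B]

/-! ## §1 Hilbert 90 in Tate form as exactness of `B →ω B →ν B` -/

/-- `B[ν] ≤ ωB` together with `νωB = 0` is exactness of `B --ω--> B --ν--> B`. [folklore] -/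
theorem exact_lsmul_iff (ω ν : R) :
    Function.Exact (DistribSMul.toLinearMap R B ω) (DistribSMul.toLinearMap R B ν) ↔
      Submodule.torsionBy R B ν ≤ ω • (⊤ : Submodule R B) ∧ ∀ b : B, (ν * ω) • b = 0 := by
  rw [LinearMap.exact_iff, ker_lsmul_eq_torsionBy, range_lsmul_eq_smul_top]
  constructor
  · intro h
    refine ⟨h.le, fun b => ?_⟩
    have hb : ω • b ∈ Submodule.torsionBy R B ν := by
      rw [h]
      exact Submodule.smul_mem_pointwise_smul _ _ _ Submodule.mem_top
    rw [Submodule.mem_torsionBy_iff, smul_smul] at hb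
    exact hb
  · rintro ⟨h90, hB⟩
    refine le_antisymm h90 ?_
    intro x hx
    rw [Submodule.mem_smul_pointwise_iff_exists] at hx
    obtain ⟨y, -, rfl⟩ := hx
    rw [Submodule.mem_torsionBy_iff, smul_smul, hB]

/-! ## §2 Flat base change -/

section Flat

variable (S : Type w) [AddCommGroup S] [Module R S]

/-- `(ω•) ⊗ S = ω•` on `S ⊗ B`. [folklore] -/
theorem lTensor_lsmul (ω : R) :
    (DistribSMul.toLinearMap R B ω).lTensor S = DistribSMul.toLinearMap R (S ⊗[R] B) ω := by
  refine TensorProduct.ext' fun s b => ?_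
  rw [LinearMap.lTensor_tmul, DistribSMul.toLinearMap_apply, DistribSMul.toLinearMap_apply, TensorProduct.tmul_smul]

/-- **HILBERT 90 SURVIVES FLAT BASE CHANGE**: if `B[ν] ≤ ωB` and `νωB = 0`, then `(S ⊗ B)[ν] ≤ ω(S ⊗ B)` for `S` flat over `R`
(«`Ĥ⁻¹(G, M_m^× ⊗ 𝒪) = Ĥ⁻¹(G, M_m^×) ⊗ 𝒪 = 0`»). [folklore] -/
theorem torsionBy_tensor_le_smul_top [Module.Flat R S] {ω ν : R}
    (h90 : Submodule.torsionBy R B ν ≤ ω • (⊤ : Submodule R B)) (hB : ∀ b : B, (ν * ω) • b = 0) :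
    Submodule.torsionBy R (S ⊗[R] B) ν ≤ ω • (⊤ : Submodule R (S ⊗[R] B)) := by
  have hex : Function.Exact (DistribSMul.toLinearMap R B ω) (DistribSMul.toLinearMap R B ν) :=
    (exact_lsmul_iff ω ν).2 ⟨h90, hB⟩
  have hexS := Module.Flat.lTensor_exact S hex
  rw [lTensor_lsmul, lTensor_lsmul, exact_lsmul_iff] at hexS
  exact hexS.1

/-- `νω` still kills `S ⊗ B`. [folklore] -/
theorem smul_tensor_eq_zero {ω ν : R} (hB : ∀ b : B, (ν * ω) • b = 0) (x : S ⊗[R] B) : (ν * ω) • x = 0 := by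
  induction x using TensorProduct.induction_on with
  | zero => rw [smul_zero]
  | tmul s b => rw [← TensorProduct.tmul_smul, hB, TensorProduct.tmul_zero]
  | add x y hx hy => rw [smul_add, hx, hy, add_zero]

end Flat

/-! ## §3 Idempotent cuts (`χ`-parts) -/

section Idempotent

variable {e : R}

/-- `x ∈ eB ↔ ex = x` for an idempotent `e`. [folklore] -/
theorem mem_smul_top_iff_of_idempotent (he : e * e = e) (x : B) :
    x ∈ e • (⊤ : Submodule R B) ↔ e • x = x := by
  rw [Submodule.mem_smul_pointwise_iff_exists]
  constructor
  · rintro ⟨y, -, rfl⟩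
    rw [smul_smul, he]
  · intro hx
    exact ⟨x, Submodule.mem_top, hx⟩

/-- **HILBERT 90 SURVIVES IDEMPOTENT CUTS**: `eB ∩ B[ν] ≤ ω(eB)` when `B[ν] ≤ ωB` and `e` is idempotent (`x = ex = eωy = ω(ey)`).
(«the `χ`-part of a module with `Ĥ⁻¹ = 0` has `Ĥ⁻¹ = 0`», `e = e_χ`, `3 ∈ 𝒪ˣ`.) [folklore] -/
theorem inf_torsionBy_le_smul_of_idempotent (he : e * e = e) {ω ν : R}
    (h90 : Submodule.torsionBy R B ν ≤ ω • (⊤ : Submodule R B)) :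
    e • (⊤ : Submodule R B) ⊓ Submodule.torsionBy R B ν ≤ ω • (e • (⊤ : Submodule R B)) := by
  intro x hx
  obtain ⟨hxe, hxν⟩ := Submodule.mem_inf.1 hx
  rw [mem_smul_top_iff_of_idempotent he] at hxe
  have hxω := h90 hxν
  rw [Submodule.mem_smul_pointwise_iff_exists] at hxω
  obtain ⟨y, -, rfl⟩ := hxω
  rw [Submodule.mem_smul_pointwise_iff_exists]
  refine ⟨e • y, Submodule.smul_mem_pointwise_smul _ _ _ Submodule.mem_top, ?_⟩
  rw [smul_comm, hxe]

/-- The same in `↥(eB)`-currency: **`(eB)[ν] ≤ ω • ⊤` in the module `↥(e • ⊤)`** — the hypothesis `h90` of `…HilbertNinety` for the `χ`-part.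
[folklore] -/
theorem torsionBy_submodule_le_smul_top_of_idempotent (he : e * e = e) {ω ν : R}
    (h90 : Submodule.torsionBy R B ν ≤ ω • (⊤ : Submodule R B)) :
    Submodule.torsionBy R ↥(e • (⊤ : Submodule R B)) ν ≤ ω • (⊤ : Submodule R ↥(e • (⊤ : Submodule R B))) := by
  rw [torsionBy_submodule_eq_comap, smul_top_submodule_eq_comap]
  intro x hx
  rw [Submodule.mem_comap, Submodule.subtype_apply] at hx ⊢
  exact inf_torsionBy_le_smul_of_idempotent he h90 (Submodule.mem_inf.2 ⟨x.2, hx⟩)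

/-- Any scalar multiple that kills `B` kills `↥(eB)`. [folklore] -/
theorem smul_submodule_eq_zero {c : R} (hB : ∀ b : B, c • b = 0) (A : Submodule R B) (x : A) : c • x = 0 :=
  Subtype.ext (by rw [Submodule.coe_smul, Submodule.coe_zero, hB])

end Idempotent

/-! ## §4 Kernel transport along a commuting square -/

section Square

variable {A : Type*} [AddCommGroup A] [Module R A] {A' : Type*} [AddCommGroup A'] [Module R A']
  {C : Type*} [AddCommGroup C] [Module R C] {C' : Type*} [AddCommGroup C'] [Module R C']

/-- The kernel of `f` is carried onto the kernel of `g` by `eA` when `eB ∘ f = g ∘ eA` with `eB` injective. [folklore] -/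
theorem map_ker_eq_of_square (f : A →ₗ[R] C) (g : A' →ₗ[R] C') (eA : A ≃ₗ[R] A') (eB : C →ₗ[R] C')
    (heB : Function.Injective eB) (h : ∀ a, eB (f a) = g (eA a)) :
    (LinearMap.ker f).map (eA : A →ₗ[R] A') = LinearMap.ker g := by
  ext a'
  rw [Submodule.mem_map, LinearMap.mem_ker]
  constructor
  · rintro ⟨a, ha, rfl⟩
    rw [LinearMap.mem_ker] at ha
    rw [LinearEquiv.coe_coe, ← h, ha, map_zero]
  · intro ha'
    refine ⟨eA.symm a', ?_, by rw [LinearEquiv.coe_coe, LinearEquiv.apply_symm_apply]⟩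
    rw [LinearMap.mem_ker]
    apply heB
    rw [h, LinearEquiv.apply_symm_apply, ha', map_zero]

/-- **`#ker f = #ker g`** for a commuting square `eB ∘ f = g ∘ eA`, `eA` a linear equivalence, `eB` injective.
(«`#ker(Cl_n^χ → Cl_m^χ) = #ker(X^χ/ω_n → X^χ/ω_m)` under `A_k^χ ≅ X^χ/ω_kX^χ`».) [folklore] -/
theorem natCard_ker_eq_of_square (f : A →ₗ[R] C) (g : A' →ₗ[R] C') (eA : A ≃ₗ[R] A') (eB : C →ₗ[R] C')
    (heB : Function.Injective eB) (h : ∀ a, eB (f a) = g (eA a)) :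
    Nat.card (LinearMap.ker f) = Nat.card (LinearMap.ker g) := by
  rw [← map_ker_eq_of_square f g eA eB heB h]
  exact Nat.card_congr (Submodule.equivMapOfInjective _ eA.injective _).toEquiv

end Square

end Summit.BirchSwinnertonDyer.BirchSwinnertonDyer.Theorems.SignedMuAtTwo.NonsquareDescent
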